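import Summits.RiemannHypothesis.RiemannHypothesis.Theorems.SoloInformedGroundStateZeroSide

/-!
# Ground-state endgame, V: the E-map identity, kernel form (continuation)

Solo programme `solo-RiemannHypothesis-informed`, session 1 — part of the assembled endgame of
the semilocal (Weil ground state) programme (Connes 2026, arXiv:2602.04022, §6.6); overview in
`SoloInformedGroundStateLimit.lean`. Everything here is proved; the only named fact used anywhere
in the package is `Connes2026_weilGroundState_zeros_re_eq_half` (C–vS Thm. 6.1), as a hypothesis.

Riemann's unfolding with a dilation `mellin (u ↦ ∑ h(nu/λ)) s = λ^s ζ(s) mellin h s`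
(`mellin_dilatedSum_eq`) and the abstract continuation `window transform = Φ − leak transform`
on the punctured half-plane `{0 < Re s} ∖ {1}` (`mellin_eq_indicator_add`,
`mellin_indicator_Ioi_eq_of_eqOn`).
-/

noncomputable section

open Complex Filter Set Topology Metric MeasureTheory
open Literature.NumberTheory.LFunctions

namespace Summit.RiemannHypothesis.RiemannHypothesis.Theorems

section EMap

open Asymptotics

/-- Riemann's unfolding with a dilation: `mellin (u ↦ ∑_{n ≥ 1} h(n u/λ)) s = λ^s ζ(s) mellin h s`
for `1 < Re s`. -/
theorem mellin_dilatedSum_eq (h : SchwartzMap ℝ ℂ) {lam : ℝ} (hlam : 0 < lam) {s : ℂ}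
    (hs : 1 < s.re) :
    mellin (fun u : ℝ => ∑' n : ℕ, h (((n + 1 : ℕ) : ℝ) * (lam⁻¹ * u))) s =
      (lam : ℂ) ^ s * riemannZeta s * mellin (fun x : ℝ => h x) s := by
  have key := Literature.NumberTheory.Automorphic.Meyer.mellin_tsum_coeff h (a := 1) (B := 1)
    (fun n => by simp) (inv_pos.2 hlam) hs
  simp only [Pi.one_apply, one_mul] at key
  rw [key, LSeries_one_eq_riemannZeta hs]
  congr 1
  congr 1
  have hlam' : (lam : ℂ) ≠ 0 := by exact_mod_cast hlam.ne'
  rw [Complex.ofReal_inv, Complex.inv_cpow _ _ (by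
      rw [Complex.arg_ofReal_of_nonneg hlam.le]; exact Real.pi_pos.ne), Complex.cpow_neg, inv_inv]

set_option linter.unnecessarySeqFocus false in
/-- The punctured right half-plane `{0 < Re s} ∖ {1}` is preconnected. -/
theorem isPreconnected_reHalfPlane_ne_one : IsPreconnected {s : ℂ | 0 < s.re ∧ s ≠ 1} := by
  have hA : IsPreconnected ({c : ℂ | 0 < c.re} ∩ {c : ℂ | 0 < c.im}) :=
    ((convex_halfSpace_re_gt 0).inter (convex_halfSpace_im_gt 0)).isPreconnected
  have hB : IsPreconnected {c : ℂ | 1 < c.re} := (convex_halfSpace_re_gt 1).isPreconnected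
  have hC : IsPreconnected ({c : ℂ | 0 < c.re} ∩ {c : ℂ | c.im < 0}) :=
    ((convex_halfSpace_re_gt 0).inter (convex_halfSpace_im_lt 0)).isPreconnected
  have hD : IsPreconnected ({c : ℂ | 0 < c.re} ∩ {c : ℂ | c.re < 1}) :=
    ((convex_halfSpace_re_gt 0).inter (convex_halfSpace_re_lt 1)).isPreconnected
  have hAB : IsPreconnected (({c : ℂ | 0 < c.re} ∩ {c : ℂ | 0 < c.im}) ∪ {c : ℂ | 1 < c.re}) := by
    refine IsPreconnected.union (2 + I) ?_ ?_ hA hB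
    · constructor <;> simp
    · simp
  have hABC : IsPreconnected ((({c : ℂ | 0 < c.re} ∩ {c : ℂ | 0 < c.im}) ∪ {c : ℂ | 1 < c.re}) ∪
      ({c : ℂ | 0 < c.re} ∩ {c : ℂ | c.im < 0})) := by
    refine IsPreconnected.union (2 - I) ?_ ?_ hAB hC
    · right; simp
    · constructor <;> simp
  have hABCD : IsPreconnected (((({c : ℂ | 0 < c.re} ∩ {c : ℂ | 0 < c.im}) ∪ {c : ℂ | 1 < c.re}) ∪
      ({c : ℂ | 0 < c.re} ∩ {c : ℂ | c.im < 0})) ∪ ({c : ℂ | 0 < c.re} ∩ {c : ℂ | c.re < 1})) := by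
    refine IsPreconnected.union ((1 / 2 : ℂ) + I) ?_ ?_ hABC hD
    · left; left; constructor <;> simp
    · constructor <;> simp <;> norm_num
  convert hABCD using 1
  ext c
  simp only [mem_setOf_eq, mem_union, mem_inter_iff]
  constructor
  · rintro ⟨hre, hne⟩
    rcases lt_trichotomy c.im 0 with him | him | him
    · exact Or.inl (Or.inr ⟨hre, him⟩)
    · have hre1 : c.re ≠ 1 := by
        intro h1
        exact hne (Complex.ext (by simp [h1]) (by simp [him]))
      rcases lt_or_gt_of_ne hre1 with h | h
      · exact Or.inr ⟨hre, h⟩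
      · exact Or.inl (Or.inl (Or.inr h))
    · exact Or.inl (Or.inl (Or.inl ⟨hre, him⟩))
  · rintro (((⟨hre, him⟩ | hre) | ⟨hre, him⟩) | ⟨hre, hre1⟩)
    · exact ⟨hre, fun h1 => by simp [h1] at him⟩
    · exact ⟨by linarith, fun h1 => by simp [h1] at hre⟩
    · exact ⟨hre, fun h1 => by simp [h1] at him⟩
    · exact ⟨hre, fun h1 => by simp [h1] at hre1⟩

/-- The punctured right half-plane is open. -/
theorem isOpen_reHalfPlane_ne_one : IsOpen {s : ℂ | 0 < s.re ∧ s ≠ 1} :=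
  (isOpen_lt continuous_const Complex.continuous_re).inter isOpen_ne

/-- A bounded measurable function vanishing beyond `u₁` and below `u₀ > 0` (the WINDOW part of an E-map
image) has an entire Mellin transform: differentiable at every `s`. -/
theorem differentiableAt_mellin_indicator_Ioi {S : ℝ → ℂ} {u₀ u₁ C : ℝ} (hu₀ : 0 < u₀)
    (hSm : AEStronglyMeasurable S volume) (hSb : ∀ u, 0 < u → ‖S u‖ ≤ C) (hS0 : ∀ u, u₁ ≤ u → S u = 0)
    (s : ℂ) : DifferentiableAt ℂ (mellin ((Ioi u₀).indicator S)) s := by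
  set f : ℝ → ℂ := (Ioi u₀).indicator S with hf
  have hC : 0 ≤ C := le_trans (norm_nonneg _) (hSb 1 one_pos)
  -- f is integrable on ℝ: bounded, measurable, supported in `Ioc u₀ u₁`
  have hfeq : f = (Ioc u₀ u₁).indicator S := by
    funext u
    by_cases hu : u ∈ Ioi u₀
    · by_cases hu' : u ≤ u₁
      · rw [hf, indicator_of_mem hu, indicator_of_mem (show u ∈ Ioc u₀ u₁ from ⟨hu, hu'⟩)]
      · rw [hf, indicator_of_mem hu, indicator_of_notMem (fun h => hu' h.2), hS0 u (le_of_not_ge hu')]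
    · rw [hf, indicator_of_notMem hu, indicator_of_notMem (fun h => hu h.1)]
  have hint : Integrable f volume := by
    rw [hfeq]
    have hIO : IntegrableOn S (Ioc u₀ u₁) volume :=
      Measure.integrableOn_of_bounded (M := C) measure_Ioc_lt_top.ne hSm
        ((ae_restrict_mem measurableSet_Ioc).mono fun u hu => hSb u (hu₀.trans hu.1))
    exact hIO.integrable_indicator measurableSet_Ioc
  have hloc : LocallyIntegrableOn f (Ioi 0) := hint.integrableOn.locallyIntegrableOn
  -- eventually zero at both ends
  have htop : f =O[atTop] fun t : ℝ => t ^ (-(s.re + 1)) := by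
    have : f =ᶠ[atTop] fun _ => (0 : ℂ) := by
      filter_upwards [eventually_ge_atTop (max u₁ u₀ + 1)] with u hu
      rw [hfeq, indicator_of_notMem]
      intro h
      have := h.2
      linarith [le_max_left u₁ u₀]
    exact this.trans_isBigO (isBigO_zero _ _)
  have hbot : f =O[𝓝[>] 0] fun t : ℝ => t ^ (-(s.re - 1)) := by
    have : f =ᶠ[𝓝[>] 0] fun _ => (0 : ℂ) := by
      have hmem : Ioo (0 : ℝ) u₀ ∈ 𝓝[>] (0 : ℝ) := Ioo_mem_nhdsGT hu₀
      filter_upwards [hmem] with u hu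
      rw [hf, indicator_of_notMem]
      exact fun h => (not_lt.2 (le_of_lt hu.2)) h
    exact this.trans_isBigO (isBigO_zero _ _)
  exact mellin_differentiableAt_of_isBigO_rpow hloc htop (by linarith) hbot (by linarith)

/-- The LEAK part `1_{(0,u₀]} S` of a bounded measurable `S` has a Mellin transform holomorphic on
`0 < Re s`. -/
theorem differentiableAt_mellin_indicator_Ioc {S : ℝ → ℂ} {u₀ C : ℝ}
    (hSm : AEStronglyMeasurable S volume) (hSb : ∀ u, 0 < u → ‖S u‖ ≤ C)
    {s : ℂ} (hs : 0 < s.re) : DifferentiableAt ℂ (mellin ((Ioc 0 u₀).indicator S)) s := by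
  set f : ℝ → ℂ := (Ioc 0 u₀).indicator S with hf
  have hC : 0 ≤ C := le_trans (norm_nonneg _) (hSb 1 one_pos)
  have hint : Integrable f volume := by
    have hIO : IntegrableOn S (Ioc 0 u₀) volume :=
      Measure.integrableOn_of_bounded (M := C) measure_Ioc_lt_top.ne hSm
        ((ae_restrict_mem measurableSet_Ioc).mono fun u hu => hSb u hu.1)
    exact hIO.integrable_indicator measurableSet_Ioc
  have hloc : LocallyIntegrableOn f (Ioi 0) := hint.integrableOn.locallyIntegrableOn
  have htop : f =O[atTop] fun t : ℝ => t ^ (-(s.re + 1)) := by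
    have : f =ᶠ[atTop] fun _ => (0 : ℂ) := by
      filter_upwards [eventually_gt_atTop u₀] with u hu
      rw [hf, indicator_of_notMem]
      exact fun h => (not_le.2 hu) h.2
    exact this.trans_isBigO (isBigO_zero _ _)
  have hbot : f =O[𝓝[>] 0] fun t : ℝ => t ^ (-(0 : ℝ)) := by
    refine IsBigO.of_bound C ?_
    filter_upwards [self_mem_nhdsWithin] with u (hu : 0 < u)
    rw [neg_zero, Real.rpow_zero, Real.norm_eq_abs, abs_one, mul_one]
    rw [hf]
    by_cases h : u ∈ Ioc 0 u₀
    · rw [indicator_of_mem h]; exact hSb u hu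
    · rw [indicator_of_notMem h, norm_zero]; exact hC
  exact mellin_differentiableAt_of_isBigO_rpow hloc htop (by linarith) hbot (by simpa using hs)

/-- Splitting the Mellin transform into leak + window parts, for `0 < Re s`. -/
theorem mellin_eq_indicator_add {S : ℝ → ℂ} {u₀ u₁ C : ℝ} (hu₀ : 0 < u₀)
    (hSm : AEStronglyMeasurable S volume) (hSb : ∀ u, 0 < u → ‖S u‖ ≤ C) (hS0 : ∀ u, u₁ ≤ u → S u = 0)
    {s : ℂ} (hs : 0 < s.re) :
    mellin S s = mellin ((Ioc 0 u₀).indicator S) s + mellin ((Ioi u₀).indicator S) s := by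
  have hC : 0 ≤ C := le_trans (norm_nonneg _) (hSb 1 one_pos)
  -- Mellin convergence of the two pieces at s
  have hint1 : Integrable ((Ioc 0 u₀).indicator S) volume := by
    have hIO : IntegrableOn S (Ioc 0 u₀) volume :=
      Measure.integrableOn_of_bounded (M := C) measure_Ioc_lt_top.ne hSm
        ((ae_restrict_mem measurableSet_Ioc).mono fun u hu => hSb u hu.1)
    exact hIO.integrable_indicator measurableSet_Ioc
  have hfeq : (Ioi u₀).indicator S = (Ioc u₀ u₁).indicator S := by
    funext u
    by_cases hu : u ∈ Ioi u₀
    · by_cases hu' : u ≤ u₁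
      · rw [indicator_of_mem hu, indicator_of_mem (show u ∈ Ioc u₀ u₁ from ⟨hu, hu'⟩)]
      · rw [indicator_of_mem hu, indicator_of_notMem (fun h => hu' h.2), hS0 u (le_of_not_ge hu')]
    · rw [indicator_of_notMem hu, indicator_of_notMem (fun h => hu h.1)]
  have hint2 : Integrable ((Ioi u₀).indicator S) volume := by
    rw [hfeq]
    have hIO : IntegrableOn S (Ioc u₀ u₁) volume :=
      Measure.integrableOn_of_bounded (M := C) measure_Ioc_lt_top.ne hSm
        ((ae_restrict_mem measurableSet_Ioc).mono fun u hu => hSb u (hu₀.trans hu.1))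
    exact hIO.integrable_indicator measurableSet_Ioc
  have hconv1 : MellinConvergent ((Ioc 0 u₀).indicator S) s := by
    refine mellinConvergent_of_isBigO_rpow (a := s.re + 1) (b := 0)
      hint1.integrableOn.locallyIntegrableOn ?_ (by linarith) ?_ (by simpa using hs)
    · have : (Ioc 0 u₀).indicator S =ᶠ[atTop] fun _ => (0 : ℂ) := by
        filter_upwards [eventually_gt_atTop u₀] with u hu
        rw [indicator_of_notMem]
        exact fun h => (not_le.2 hu) h.2
      exact this.trans_isBigO (isBigO_zero _ _)
    · refine IsBigO.of_bound C ?_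
      filter_upwards [self_mem_nhdsWithin] with u (hu : 0 < u)
      rw [neg_zero, Real.rpow_zero, Real.norm_eq_abs, abs_one, mul_one]
      by_cases h : u ∈ Ioc 0 u₀
      · rw [indicator_of_mem h]; exact hSb u hu
      · rw [indicator_of_notMem h, norm_zero]; exact hC
  have hconv2 : MellinConvergent ((Ioi u₀).indicator S) s := by
    refine mellinConvergent_of_isBigO_rpow (a := s.re + 1) (b := s.re - 1)
      hint2.integrableOn.locallyIntegrableOn ?_ (by linarith) ?_ (by linarith)
    · have : (Ioi u₀).indicator S =ᶠ[atTop] fun _ => (0 : ℂ) := by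
        filter_upwards [eventually_ge_atTop (max u₁ u₀ + 1)] with u hu
        rw [hfeq, indicator_of_notMem]
        intro h
        have := h.2
        linarith [le_max_left u₁ u₀]
      exact this.trans_isBigO (isBigO_zero _ _)
    · have : (Ioi u₀).indicator S =ᶠ[𝓝[>] 0] fun _ => (0 : ℂ) := by
        filter_upwards [Ioo_mem_nhdsGT hu₀] with u hu
        rw [indicator_of_notMem]
        exact fun h => (not_lt.2 (le_of_lt hu.2)) h
      exact this.trans_isBigO (isBigO_zero _ _)
  rw [mellin, mellin, mellin, ← integral_add hconv1 hconv2]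
  refine setIntegral_congr_fun measurableSet_Ioi fun t (ht : 0 < t) => ?_
  simp only [← smul_add]
  congr 1
  by_cases h : t ≤ u₀
  · rw [indicator_of_mem (show t ∈ Ioc 0 u₀ from ⟨ht, h⟩), indicator_of_notMem (show t ∉ Ioi u₀ from
      fun h' => (not_lt.2 h) h'), add_zero]
  · rw [indicator_of_notMem (show t ∉ Ioc 0 u₀ from fun h' => h h'.2),
      indicator_of_mem (show t ∈ Ioi u₀ from lt_of_not_ge h), zero_add]

/-- **Abstract continuation of the E-map identity.** If `mellin S = Φ` on `1 < Re s`, with `S` bounded,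
measurable and vanishing beyond `u₁`, and `Φ` holomorphic on the punctured half-plane `{0 < Re s} ∖ {1}`,
then on that whole domain the WINDOW transform equals `Φ` minus the LEAK transform:
`mellin (1_{(u₀,∞)} S) s = Φ s − mellin (1_{(0,u₀]} S) s`. At a zero of `Φ` (e.g. `Φ = λ^s ζ(s) Mh(s)`
at a non-trivial zero of `ζ`) the window transform IS minus the leak transform. -/
theorem mellin_indicator_Ioi_eq_of_eqOn {S : ℝ → ℂ} {u₀ u₁ C : ℝ} (hu₀ : 0 < u₀)
    (hSm : AEStronglyMeasurable S volume) (hSb : ∀ u, 0 < u → ‖S u‖ ≤ C) (hS0 : ∀ u, u₁ ≤ u → S u = 0)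
    {Φ : ℂ → ℂ} (hΦ : DifferentiableOn ℂ Φ {s : ℂ | 0 < s.re ∧ s ≠ 1})
    (heq : ∀ s : ℂ, 1 < s.re → mellin S s = Φ s)
    {s : ℂ} (hs : 0 < s.re) (hs1 : s ≠ 1) :
    mellin ((Ioi u₀).indicator S) s = Φ s - mellin ((Ioc 0 u₀).indicator S) s := by
  set U : Set ℂ := {s : ℂ | 0 < s.re ∧ s ≠ 1} with hU
  set F : ℂ → ℂ := fun s => mellin ((Ioi u₀).indicator S) s + mellin ((Ioc 0 u₀).indicator S) s - Φ s
    with hF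
  have hFd : DifferentiableOn ℂ F U := by
    refine DifferentiableOn.sub (DifferentiableOn.add ?_ ?_) hΦ
    · exact fun z _ => (differentiableAt_mellin_indicator_Ioi hu₀ hSm hSb hS0 z).differentiableWithinAt
    · exact fun z hz => (differentiableAt_mellin_indicator_Ioc (u₀ := u₀) hSm hSb hz.1).differentiableWithinAt
  have hFa : AnalyticOnNhd ℂ F U := hFd.analyticOnNhd isOpen_reHalfPlane_ne_one
  -- F vanishes on the open set {1 < Re s} ∋ 2
  have h2 : (2 : ℂ) ∈ U := ⟨by simp, by norm_num⟩
  have hF0 : F =ᶠ[𝓝 (2 : ℂ)] 0 := by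
    have hopen : IsOpen {z : ℂ | 1 < z.re} := isOpen_lt continuous_const Complex.continuous_re
    filter_upwards [hopen.mem_nhds (show (2 : ℂ) ∈ {z : ℂ | 1 < z.re} by simp)] with z hz
    have hz' : 1 < z.re := hz
    simp only [hF, Pi.zero_apply]
    rw [← heq z hz', mellin_eq_indicator_add hu₀ hSm hSb hS0 (by linarith : 0 < z.re)]
    ring
  have hzero := hFa.eqOn_zero_of_preconnected_of_eventuallyEq_zero isPreconnected_reHalfPlane_ne_one h2 hF0
  have := hzero (show s ∈ U from ⟨hs, hs1⟩)
  simp only [hF, Pi.zero_apply] at this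
  linear_combination this

end EMap

end Summit.RiemannHypothesis.RiemannHypothesis.Theorems
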